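import Summits.FinalStateConjecture.FinalStateConjecture.Cruxes.ChannelsResolveTameDevelopmentsR.Disproof

/-!
# K2R ≡ Φ, unconditionally (crux stmt-FinalStateConjecture-14075, lead c2, 2026-08-16)

The antecedent `K1R = UniformPhotonSphereChannelsR` of the crux
`ChannelsResolveTameDevelopmentsR := K1R → Φ` is now a THEOREM of the tree
(`Theorems.uniformPhotonSphereChannelsR_proof`, whose type is the route decl body verbatim and which the route file imports, line `crum-peeling-recessive-tower`, item 14074 closed).
Hence the crux is EQUIVALENT to its consequent `Φ = Disproof.TameResolution` (tame final-state
resolution), with no hypothesis left: the door `¬K1R → K2R` (`Disproof.k2R_of_not_k1R`) is shut, and a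
proof of K2R is exactly a proof of Φ. Recorded here as the one-line corollary of `Disproof.k2R_iff` so that
planners and later seats can cite it by name. No `sorry`.
-/

set_option linter.dupNamespace false

namespace Summit.FinalStateConjecture.FinalStateConjecture.Cruxes.ChannelsResolveTameDevelopmentsR

open Summit.FinalStateConjecture.FinalStateConjecture.Theses.PhotonSphereChannels

/-- **K2R ↔ Φ.** With K1R proved (`Theorems.uniformPhotonSphereChannelsR_proof`), the crux
`ChannelsResolveTameDevelopmentsR` is equivalent to tame resolution `Disproof.TameResolution`. [folklore] -/
theorem k2R_iff_tameResolution : ChannelsResolveTameDevelopmentsR ↔ Disproof.TameResolution :=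
  Disproof.k2R_iff_tameResolution_of_k1R
    _root_.Summit.FinalStateConjecture.FinalStateConjecture.Theorems.uniformPhotonSphereChannelsR_proof

/-- **Φ is now the whole crux**: any proof of K2R yields tame resolution outright. [folklore] -/
theorem tameResolution_of_k2R (h : ChannelsResolveTameDevelopmentsR) : Disproof.TameResolution :=
  k2R_iff_tameResolution.1 h

/-- **The route's hypotheses reduce to Φ ∧ TameCensorship** (K1R discharged): cf. `Disproof.hypotheses_iff`. [folklore] -/
theorem route_hypotheses_iff :
    (UniformPhotonSphereChannelsR ∧ ChannelsResolveTameDevelopmentsR ∧ TameCensorship) ↔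
      (Disproof.TameResolution ∧ TameCensorship) :=
  ⟨fun h ↦ ⟨tameResolution_of_k2R h.2.1, h.2.2⟩,
    fun h ↦ ⟨_root_.Summit.FinalStateConjecture.FinalStateConjecture.Theorems.uniformPhotonSphereChannelsR_proof,
      Disproof.k2R_of_tameResolution h.1, h.2⟩⟩

end Summit.FinalStateConjecture.FinalStateConjecture.Cruxes.ChannelsResolveTameDevelopmentsR
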